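import Summits.Ventures.PercRepro.RankLevelSetPerElemThreeDual
import Summits.Ventures.PercRepro.RankLevelSetPerElemReduce

/-! # RankLevelSetPerElemThreeGood — THE THREE GOOD PAIRS OF A TRIANGLE MEMBER, AND (★★) AT LEVEL `3`, MONO'S
STEP `j = 3`, AND THE STEP `k = 4` OF (ABS-star) AT A PARALLEL ELEMENT, FOR EVERY FINITE MATROID (night-1 g36;
dossier §48; on `RankLevelSetPerElemThreeDual` and `RankLevelSetPerElemReduce`)

For an absorbing `3`-set `Z = S ∪ {c}` whose circuit with `y` is the triangle `insert y S`, with `y` in no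
parallel pair and `M` coloop-free, the hypothesis `hB` of `perElemAt_three_of_exists` — at least three pairs
`T ⊆ J := E ∖ insert y Z` with `insert y (insert c T) ∈ D_4` — is proved in the DUAL `N := M✶` (loopless, of rank
`≤ 3`): `insert y (insert c T)` is bi-independent iff it and its complement `S ∪ (J ∖ T)` both span `N`
(`mem_biIndep_iff_dual`). Since `y ∉ cl_N (insert c J)` while `insert y (insert c J) = E ∖ S` spans, the set
`insert y (insert c T)` spans as soon as `T` contains a `c`-FULL element `t` (`cl_N {c, t} = cl_N (insert c J)`);
since `S ∪ J = E ∖ {y, c}` spans, the complement spans as soon as `J ∖ T` contains an `S`-FULL element `u`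
(`insert u S` spans `N`). Some element of `J` is `c`-full and some is `S`-full, and EVERY element of `J` is
`c`-full or `S`-full (`c ∈ cl_N {t}` and `insert c S` spanning would make `insert t S` spanning) — so the
pair-counting lemma `three_le_ncard_pairs` gives the three good pairs (**`three_le_good_pairs`**). With
`exists_through_quadruple` (`hA`), `perElemAt_three_of_exists` and `perElemAt_three_of_simple` this closes (★★) at
level `3` for EVERY finite matroid and element (**`perElemAt_three`**), Mono's step `j = 3`
(**`mono_step_three`**: `(#E − 3) · D_3 ≤ 4 · D_4` for `8 ≤ #E`), and the step `k = 4` of (ABS-star) at every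
element of a parallel pair (**`absorbStar_step_four_of_parallel`**). Every declaration has a docstring; imports:
the cell's own modules and Mathlib only. Axioms: standard. -/

namespace PercRepro

open Set Matroid

variable {α : Type} (M : Matroid α) [M.Finite]

/-! ## The structure of a triangle member -/

omit [M.Finite] in
/-- For an absorbing `3`-set `Z` whose circuit with `y` has three elements and `Z ∖ C = {c}`: with
`S := C ∖ {y}`, `C = insert y S`, `S ⊆ Z`, `#S = 2`, `c ∉ S`, `Z = insert c S`, and `c ∈ Z`. -/
lemma triangle_member_structure {y : α} {Z : Set α} (hZ : Z ∈ lowAbsorbAt M y 3)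
    (hC3 : (M.fundCircuit y Z).ncard = 3) {c : α} (hc : Z \ M.fundCircuit y Z = {c}) :
    M.fundCircuit y Z = insert y (M.fundCircuit y Z \ {y}) ∧ M.fundCircuit y Z \ {y} ⊆ Z ∧
      (M.fundCircuit y Z \ {y}).ncard = 2 ∧ c ∉ M.fundCircuit y Z \ {y} ∧
      Z = insert c (M.fundCircuit y Z \ {y}) ∧ c ∈ Z := by
  have hyC : y ∈ M.fundCircuit y Z := M.mem_fundCircuit y Z
  have hCsub : M.fundCircuit y Z ⊆ insert y Z := M.fundCircuit_subset_insert y Z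
  obtain ⟨⟨hZE, hZ3, -, -⟩, hyZ, -⟩ := hZ
  have hcZ : c ∈ Z \ M.fundCircuit y Z := by rw [hc]; exact Set.mem_singleton c
  have hSZ : M.fundCircuit y Z \ {y} ⊆ Z := by
    rintro x ⟨hxC, hxy⟩
    rcases hCsub hxC with h | h
    · exact absurd h hxy
    · exact h
  refine ⟨(Set.insert_eq_of_mem hyC).symm.trans (by rw [Set.insert_sdiff_singleton]), hSZ, ?_, ?_, ?_, hcZ.1⟩
  · rw [Set.ncard_sdiff_singleton_of_mem hyC, hC3]
  · exact fun h => hcZ.2 h.1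
  · ext x
    simp only [Set.mem_insert_iff, Set.mem_sdiff, Set.mem_singleton_iff]
    constructor
    · intro hxZ
      by_cases hxC : x ∈ M.fundCircuit y Z
      · exact Or.inr ⟨hxC, fun h => hyZ (h ▸ hxZ)⟩
      · left
        have : x ∈ Z \ M.fundCircuit y Z := ⟨hxZ, hxC⟩
        rw [hc] at this
        exact this
    · rintro (rfl | ⟨hxC, hxy⟩)
      · exact hcZ.1
      · exact hSZ ⟨hxC, hxy⟩

/-! ## The three good pairs -/

/-- **THE THREE GOOD PAIRS OF A TRIANGLE MEMBER** (the hypothesis `hB` of `perElemAt_three_of_exists`): for `y ∈ E`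
in no parallel pair, `M` coloop-free, `8 ≤ #E`, an absorbing `3`-set `Z` whose circuit with `y` has three elements,
and `c` the element of `Z` off that circuit, at least three pairs `T ⊆ E ∖ insert y Z` have
`insert y (insert c T) ∈ D_4`. PROOF in the dual `N = M✶`, with `S := C ∖ {y}` (so `Z = insert c S`) and
`J := E ∖ insert y Z`: `y ∉ cl_N (insert c J)` (`insert c J = E ∖ insert y S` does not span, `E ∖ S` does),
`S ∪ J = E ∖ {y, c}` and `insert c S = Z` span `N`, `N` has rank `≤ 3`, and every element of `J ∪ {c}` is a
nonloop of `N`. Call `t ∈ J` `c`-FULL if `cl_N {c, t} = cl_N (insert c J)` and `u ∈ J` `S`-FULL if `insert u S`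
spans `N`. A pair `T` with a `c`-full element inside and an `S`-full element outside is good: `insert y (insert c T)`
spans `N` (its closure is that of `insert y (insert c J) = E ∖ S`) and so does its complement `S ∪ (J ∖ T) ⊇ insert u S`.
Some `t ∈ J` is `c`-full (if `J ⊄ cl_N {c}`, a `t ∉ cl_N {c}` has `rk_N {c, t} = 2 ≥ rk_N (insert c J)`; else every
`t` is), some `u ∈ J` is `S`-full (if `S` does not span, a `u ∈ J ∖ cl_N S` exists and `rk_N (insert u S) =
rk_N S + 1 ≥ rk_N (insert c S) = rk N`), and every `t ∈ J` is `c`-full or `S`-full (if `c ∈ cl_N {t}` then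
`insert c S ⊆ cl_N (insert t S)` spans, so `insert t S` spans; else `rk_N {c, t} = 2`). The pair-counting lemma
`three_le_ncard_pairs` finishes. -/
theorem three_le_good_pairs {y : α} (hy : y ∈ M.E) (hnp : ∀ z, z ≠ y → y ∉ M.closure {z})
    (hcol : ∀ e, ¬ M.IsColoop e) (hn : 8 ≤ M.E.ncard) {Z : Set α} (hZ : Z ∈ lowAbsorbAt M y 3)
    (hC3 : (M.fundCircuit y Z).ncard = 3) {c : α} (hc : Z \ M.fundCircuit y Z = {c}) :
    3 ≤ {T | T ⊆ M.E \ insert y Z ∧ T.ncard = 2 ∧ insert y (insert c T) ∈ biIndep M 4}.ncard := by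
  -- the structure of the member
  obtain ⟨hCeq, hSZ, hS2, hcS, hZeq, hcZ⟩ := triangle_member_structure M hZ hC3 hc
  obtain ⟨hIeq, hIs, hJns, hyJ, hZs, hrank⟩ := absorb_three_dual_facts M hy hZ
  have hycl := mem_closure_of_mem_lowAbsorbAt' M hy hZ
  obtain ⟨⟨hZE, hZ3, hZi, hcind⟩, hyZ, hdep⟩ := hZ
  set C := M.fundCircuit y Z with hC
  set S := C \ {y} with hS
  set J := M.E \ insert y Z with hJ
  have hCcirc : M.IsCircuit C := hZi.fundCircuit_isCircuit hycl hyZ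
  have hSE : S ⊆ M.E := hSZ.trans hZE
  have hJE : J ⊆ M.E := Set.sdiff_subset
  have hJfin : J.Finite := M.ground_finite.subset hJE
  have hJcard : 4 ≤ J.ncard := by
    rw [hJ, ncard_compl_insert_three M hy hZE hZ3 hyZ]; omega
  have hcE : c ∈ M.E := hZE hcZ
  have hcy : c ≠ y := fun h => hyZ (h ▸ hcZ)
  have hcJ : c ∉ J := fun h => h.2 (Set.mem_insert_of_mem y hcZ)
  have hyJ' : y ∉ J := fun h => h.2 (Set.mem_insert y Z)
  have hSi : M.Indep S := hZi.subset hSZ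
  have hSdep : ¬ M.Indep (insert y S) := by rw [← hCeq]; exact hCcirc.dep.not_indep
  have hyc : M.Indep ({y, c} : Set α) := by
    have hcn : M.IsNonloop c := hZi.isNonloop_of_mem hcZ
    rw [show ({y, c} : Set α) = insert y {c} from rfl,
      (Matroid.indep_singleton.mpr hcn).insert_indep_iff_of_notMem (by simpa using hcy.symm)]
    exact ⟨hy, hnp c hcy⟩
  -- set identities
  have hE1 : M.E \ S = insert y (insert c J) := by
    ext x
    simp only [hJ, hZeq, Set.mem_sdiff, Set.mem_insert_iff, not_or]
    constructor
    · rintro ⟨hxE, hxS⟩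
      by_cases hxy : x = y
      · exact Or.inl hxy
      by_cases hxc : x = c
      · exact Or.inr (Or.inl hxc)
      · exact Or.inr (Or.inr ⟨hxE, hxy, hxc, hxS⟩)
    · rintro (rfl | rfl | ⟨hxE, -, -, hxS⟩)
      · exact ⟨hy, fun h => hyZ (hSZ h)⟩
      · exact ⟨hcE, hcS⟩
      · exact ⟨hxE, hxS⟩
  have hE2 : M.E \ insert y S = insert c J := by
    ext x
    simp only [hJ, hZeq, Set.mem_sdiff, Set.mem_insert_iff, not_or]
    constructor
    · rintro ⟨hxE, hxy, hxS⟩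
      by_cases hxc : x = c
      · exact Or.inl hxc
      · exact Or.inr ⟨hxE, hxy, hxc, hxS⟩
    · rintro (rfl | ⟨hxE, hxy, -, hxS⟩)
      · exact ⟨hcE, hcy, hcS⟩
      · exact ⟨hxE, hxy, hxS⟩
  have hE3 : M.E \ {y, c} = S ∪ J := by
    ext x
    simp only [hJ, hZeq, Set.mem_sdiff, Set.mem_insert_iff, Set.mem_singleton_iff, Set.mem_union, not_or]
    constructor
    · rintro ⟨hxE, hxy, hxc⟩
      by_cases hxS : x ∈ S
      · exact Or.inl hxS
      · exact Or.inr ⟨hxE, hxy, hxc, hxS⟩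
    · rintro (hxS | ⟨hxE, hxy, hxc, -⟩)
      · exact ⟨hSE hxS, fun h => hyZ (h ▸ hSZ hxS), fun h => hcS (h ▸ hxS)⟩
      · exact ⟨hxE, hxy, hxc⟩
  have hE4 : ∀ T ⊆ J, M.E \ insert y (insert c T) = S ∪ (J \ T) := by
    intro T hTJ
    ext x
    simp only [hJ, hZeq, Set.mem_sdiff, Set.mem_insert_iff, Set.mem_union, not_or]
    constructor
    · rintro ⟨hxE, hxy, hxc, hxT⟩
      by_cases hxS : x ∈ S
      · exact Or.inl hxS
      · exact Or.inr ⟨⟨hxE, hxy, hxc, hxS⟩, hxT⟩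
    · rintro (hxS | ⟨⟨hxE, hxy, hxc, -⟩, hxT⟩)
      · refine ⟨hSE hxS, fun h => hyZ (h ▸ hSZ hxS), fun h => hcS (h ▸ hxS), fun h => ?_⟩
        exact (hTJ h).2 (Set.mem_insert_of_mem y (hZeq ▸ Set.mem_insert_of_mem c hxS))
      · exact ⟨hxE, hxy, hxc, hxT⟩
  -- the dual facts
  have hN1 : M✶.Spanning (insert y (insert c J)) := by
    rw [← hE1]; exact (indep_iff_dual_spanning_compl M hSE).mp hSi
  have hN2 : ¬ M✶.Spanning (insert c J) := by
    rw [← hE2]; exact fun h => hSdep ((indep_iff_dual_spanning_compl M (Set.insert_subset hy hSE)).mpr h)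
  have hN3 : y ∉ M✶.closure (insert c J) := notMem_closure_of_spanning_insert hN1 hN2
  have hN4 : M✶.Spanning (S ∪ J) := by
    rw [← hE3]
    exact (indep_iff_dual_spanning_compl M (Set.pair_subset hy hcE)).mp hyc
  have hN5 : M✶.Spanning (insert c S) := by rw [← hZeq]; exact hZs
  have hyE' : y ∈ M✶.E := by rwa [Matroid.dual_ground]
  have hcE' : c ∈ M✶.E := by rwa [Matroid.dual_ground]
  have hJE' : J ⊆ M✶.E := by rwa [Matroid.dual_ground]
  have hSE' : S ⊆ M✶.E := by rwa [Matroid.dual_ground]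
  have hN6 : M✶.eRk (insert c J) ≤ 2 := by
    have h1 := eRk_add_one_eq_eRank_of_spanning_insert hyE' hN3 hN1
    have h2 : M✶.eRk (insert c J) + 1 ≤ 2 + 1 := by rw [h1]; exact hrank
    exact (WithTop.add_le_add_iff_right (by decide)).mp h2
  have hnonloop : ∀ t ∈ M.E, M✶.eRk {t} = 1 := by
    intro t ht
    rw [Matroid.eRk_singleton_eq_one_iff]
    refine Matroid.isNonloop_of_not_isLoop (by rwa [Matroid.dual_ground]) ?_
    rw [Matroid.dual_isLoop_iff_isColoop]
    exact hcol t
  -- `c`-full and `S`-full elements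
  set P : α → Prop := fun t => M✶.closure {c, t} = M✶.closure (insert c J) with hP
  set R : α → Prop := fun u => M✶.Spanning (insert u S) with hR
  have hP_of_two : ∀ t ∈ J, 2 ≤ M✶.eRk {c, t} → P t := by
    intro t htJ h2
    refine Matroid.IsRkFinite.closure_eq_closure_of_subset_of_eRk_ge_eRk
      (M✶.isRkFinite_of_finite (Set.toFinite _)) ?_ (hN6.trans h2)
    exact Set.insert_subset_insert (Set.singleton_subset_iff.mpr htJ)
  -- (s1) some element of `J` is `c`-full
  have hs1 : ∃ t ∈ J, P t := by
    obtain ⟨t₀, ht₀⟩ : J.Nonempty := by rw [← Set.ncard_pos hJfin]; omega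
    by_cases hall : insert c J ⊆ M✶.closure {c}
    · refine ⟨t₀, ht₀, ?_⟩
      refine subset_antisymm (M✶.closure_subset_closure (Set.insert_subset_insert
        (Set.singleton_subset_iff.mpr ht₀))) ?_
      calc M✶.closure (insert c J) ⊆ M✶.closure {c} :=
            Matroid.closure_subset_closure_of_subset_closure hall
        _ ⊆ M✶.closure {c, t₀} := M✶.closure_subset_closure (Set.singleton_subset_iff.mpr (Set.mem_insert c _))
    · rw [Set.not_subset] at hall
      obtain ⟨t, htcJ, htcl⟩ := hall
      have htc : t ≠ c := fun h => htcl (h ▸ M✶.mem_closure_self c hcE')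
      have htJ : t ∈ J := by
        rcases htcJ with h | h
        · exact absurd h htc
        · exact h
      refine ⟨t, htJ, hP_of_two t htJ ?_⟩
      rw [Set.pair_comm, Matroid.eRk_insert_eq_add_one ⟨hJE' htJ, htcl⟩, hnonloop c hcE]
      rfl
  -- (s2) some element of `J` is `S`-full
  have hs2 : ∃ u ∈ J, R u := by
    obtain ⟨t₀, ht₀⟩ : J.Nonempty := by rw [← Set.ncard_pos hJfin]; omega
    by_cases hSs : M✶.Spanning S
    · exact ⟨t₀, ht₀, hSs.superset (Set.subset_insert t₀ S)
        (by rw [Matroid.dual_ground]; exact Set.insert_subset (hJE ht₀) hSE)⟩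
    · have hJcl : ¬ J ⊆ M✶.closure S := by
        intro hJcl
        apply hSs
        refine ⟨?_, hSE'⟩
        refine subset_antisymm (M✶.closure_subset_ground S) ?_
        rw [← hN4.closure_eq]
        refine Matroid.closure_subset_closure_of_subset_closure (Set.union_subset ?_ hJcl)
        exact M✶.subset_closure S hSE'
      rw [Set.not_subset] at hJcl
      obtain ⟨u, huJ, hucl⟩ := hJcl
      refine ⟨u, huJ, ?_⟩
      show M✶.Spanning (insert u S)
      have huS : insert u S ⊆ M✶.E := by
        rw [Matroid.dual_ground]; exact Set.insert_subset (hJE huJ) hSE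
      have hcS' : insert c S ⊆ M✶.E := by
        rw [Matroid.dual_ground]; exact Set.insert_subset hcE hSE
      rw [Matroid.spanning_iff_eRk_le huS, Matroid.eRk_insert_eq_add_one ⟨hJE' huJ, hucl⟩]
      calc M✶.eRank ≤ M✶.eRk (insert c S) := (Matroid.spanning_iff_eRk_le hcS').mp hN5
        _ ≤ M✶.eRk S + 1 := M✶.eRk_insert_le_add_one c S
  -- (s3) every element of `J` is `c`-full or `S`-full
  have hs3 : ∀ t ∈ J, P t ∨ R t := by
    intro t htJ
    by_cases hRt : R t
    · exact Or.inr hRt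
    left
    refine hP_of_two t htJ ?_
    have hct : c ∉ M✶.closure {t} := by
      intro hct
      apply hRt
      refine ⟨?_, by rw [Matroid.dual_ground]; exact Set.insert_subset (hJE htJ) hSE⟩
      have h1 : c ∈ M✶.closure (insert t S) :=
        M✶.closure_subset_closure (Set.singleton_subset_iff.mpr (Set.mem_insert t S)) hct
      rw [← Matroid.closure_insert_eq_of_mem_closure h1]
      exact hN5.closure_eq_of_superset (Set.insert_subset_insert (Set.subset_insert t S))
    rw [Matroid.eRk_insert_eq_add_one ⟨hcE', hct⟩, hnonloop t (hJE htJ)]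
    rfl
  -- a pair with a `c`-full element inside and an `S`-full element outside is good
  have hgood : {T | T ⊆ J ∧ T.ncard = 2 ∧ (∃ t ∈ T, P t) ∧ (∃ u ∈ J \ T, R u)} ⊆
      {T | T ⊆ J ∧ T.ncard = 2 ∧ insert y (insert c T) ∈ biIndep M 4} := by
    rintro T ⟨hTJ, hT2, ⟨t, htT, hPt⟩, ⟨u, huJT, hRu⟩⟩
    refine ⟨hTJ, hT2, ?_⟩
    have hTfin : T.Finite := hJfin.subset hTJ
    have hcT : c ∉ T := fun h => hcJ (hTJ h)
    have hyT : y ∉ insert c T := by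
      simp only [Set.mem_insert_iff, not_or]
      exact ⟨hcy.symm, fun h => hyJ' (hTJ h)⟩
    rw [mem_biIndep_iff_dual]
    refine ⟨Set.insert_subset hy (Set.insert_subset hcE (hTJ.trans hJE)), ?_, ?_, ?_⟩
    · rw [Set.ncard_insert_of_notMem hyT (hTfin.insert c), Set.ncard_insert_of_notMem hcT hTfin, hT2]
    · rw [hE4 T hTJ]
      exact hRu.superset (Set.insert_subset (Set.mem_union_right S huJT) Set.subset_union_left)
        (by rw [Matroid.dual_ground]; exact Set.union_subset hSE ((Set.sdiff_subset).trans hJE))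
    · refine ⟨?_, by rw [Matroid.dual_ground]; exact Set.insert_subset hy (Set.insert_subset hcE (hTJ.trans hJE))⟩
      have hclT : M✶.closure (insert c T) = M✶.closure (insert c J) := by
        refine subset_antisymm (M✶.closure_subset_closure (Set.insert_subset_insert hTJ)) ?_
        rw [← hPt]
        exact M✶.closure_subset_closure (Set.insert_subset_insert (Set.singleton_subset_iff.mpr htT))
      rw [← Matroid.closure_insert_closure_eq_closure_insert, hclT,
        Matroid.closure_insert_closure_eq_closure_insert]
      exact hN1.closure_eq
  have hfin : {T | T ⊆ J ∧ T.ncard = 2 ∧ insert y (insert c T) ∈ biIndep M 4}.Finite :=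
    hJfin.finite_subsets.subset (fun T hT => hT.1)
  exact (three_le_ncard_pairs hJfin hJcard P R hs3 hs1 hs2).trans (Set.ncard_le_ncard hgood hfin)

/-! ## (★★) at level `3` for every finite matroid -/

/-- **(★★) AT LEVEL `3` FOR A COLOOP-FREE MATROID AT AN ELEMENT IN NO PARALLEL PAIR** (`8 ≤ #E`):
`#{Z ∈ D_3 : y ∉ Z} ≤ #{Q ∈ D_4 : y ∈ Q}` — the skeleton `perElemAt_three_of_exists` with
`exists_through_quadruple` and `three_le_good_pairs`. -/
theorem perElemAt_three_of_coloopFree (hcol : ∀ e, ¬ M.IsColoop e) {y : α} (hy : y ∈ M.E)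
    (hnp : ∀ z, z ≠ y → y ∉ M.closure {z}) (hn : 8 ≤ M.E.ncard) :
    {Z ∈ biIndep M 3 | y ∉ Z}.ncard ≤ {Q ∈ biIndep M 4 | y ∈ Q}.ncard :=
  perElemAt_three_of_exists M hy hnp hn (fun Z hZ _ => exists_through_quadruple M hy (by omega) hZ)
    (fun Z hZ hC3 c hc => three_le_good_pairs M hy hnp hcol hn hZ hC3 hc)

/-- **(★★) AT LEVEL `3` FOR EVERY FINITE MATROID AND EVERY ELEMENT** (`8 ≤ #E`):
`#{Z ∈ D_3 : y ∉ Z} ≤ #{Q ∈ D_4 : y ∈ Q}` — the reductions `perElemAt_three_of_simple` (loops, parallel pairs,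
coloops) and the coloop-free case at an element in no parallel pair. -/
theorem perElemAt_three {y : α} (hy : y ∈ M.E) (hn : 8 ≤ M.E.ncard) :
    {Z ∈ biIndep M 3 | y ∉ Z}.ncard ≤ {Q ∈ biIndep M 4 | y ∈ Q}.ncard :=
  perElemAt_three_of_simple M (fun M' _ hl hp hc y hy hn => perElemAt_three_of_coloopFree M' hc hy
    (fun _ hz => notMem_closure_singleton_of_no_partner M' hy (hl y) (hp y) hz) hn) hy hn

/-- **MONO'S STEP `j = 3` FOR EVERY FINITE MATROID**: `(#E − 3) · D_3 ≤ 4 · D_4` for `8 ≤ #E`. -/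
theorem mono_step_three (hn : 8 ≤ M.E.ncard) :
    (M.E.ncard - 3) * biIndepCount M 3 ≤ 4 * biIndepCount M 4 :=
  mono_step_of_perElemAt M 3 (fun _ hy => perElemAt_three M hy hn)

/-- `D_3 ≤ D_4` on `8 ≤ #E` elements. -/
lemma biIndepCount_three_le_four (hn : 8 ≤ M.E.ncard) : biIndepCount M 3 ≤ biIndepCount M 4 := by
  have h := mono_step_three M hn
  have h4 : 4 * biIndepCount M 3 ≤ (M.E.ncard - 3) * biIndepCount M 3 :=
    Nat.mul_le_mul_right _ (by omega)
  omega

/-! ## The step `k = 4` of (ABS-star) at an element of a parallel pair -/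

/-- **THE STEP `k = 4` OF (ABS-star) AT AN ELEMENT OF A PARALLEL PAIR**: for a parallel pair `{y, z}` and
`9 ≤ #E`, `(#E − 5) · A^y_4 ≤ 4 · A^y_5` — by g32's identity `A^y_{j+1}(M) = D_j(N)` for `N = M ／ {y} ＼ {z}`
this is Mono's step `j = 3` of `N` (`mono_step_three` on `#E − 2 ≥ 8` elements), and on `7` elements the symmetry
`D_3(N) = D_4(N)`. -/
theorem absorbStar_step_four_of_parallel {y z : α} (h : ParallelPair M y z) (hn : 9 ≤ M.E.ncard) :
    (M.E.ncard - 5) * lowAbsorbCount M y 4 ≤ 4 * lowAbsorbCount M y 5 := by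
  haveI := contract_delete_finite M y z
  have hcard := ncard_ground_contract_delete M h
  rw [lowAbsorbCount_succ_of_parallel_left M h 3, lowAbsorbCount_succ_of_parallel_left M h 4]
  rcases Nat.lt_or_ge M.E.ncard 10 with h9 | h10
  · have hm : M.E.ncard = 9 := by omega
    have hsym := biIndepCount_compl ((M.contract {y}).delete {z}) 3 (by rw [hcard]; omega)
    rw [hcard, hm] at hsym
    rw [hm]
    have h4 : (9 - 2 - 3 : ℕ) = 4 := by norm_num
    rw [h4] at hsym
    rw [show (9 - 5 : ℕ) = 4 by norm_num, hsym]
  · have hstep := mono_step_three ((M.contract {y}).delete {z}) (by rw [hcard]; omega)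
    rw [hcard] at hstep
    rw [show M.E.ncard - 5 = M.E.ncard - 2 - 3 by omega]
    exact hstep

end PercRepro
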